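import Literature.Probability.RandomPlanarGeometry.SAWPolygonClasses
import Literature.Probability.RandomPlanarGeometry.SAWPolygonSurgery
import Literature.Probability.RandomPlanarGeometry.SAWPolygonOpening
import Mathlib.Combinatorics.SimpleGraph.Trails

/-!
# Join plaquettes of lattice polygons on `ℤ²`: ray-casting parity and the «at most two equal-split join
# plaquettes» lemma

Topic `Literature/Probability/RandomPlanarGeometry` (continues `SAWPolygonSurgery.lean`: `IsPolygon.exists_isPath_erase`,
`SAWPolygonOpening.lean`: `openList`, `SAWWidePolygons.lean`: `IsPolygon.exists_two_edges`).

Sources.  N. Madras, *A rigorous bound on the critical exponent for the number of lattice trees, animals, and polygons*,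
J. Stat. Phys. 78 (1995) 681–699 [Madras1995LatticeAnimalsExponent]: the polygon bound `p_n ≤ C n^{-1/2} μ^n` in `d = 2`
(§2, proved by JOINING pairs of polygons across a plaquette and decoding the join).  A. Hammond, *On self-avoiding polygons
and walks: counting, joining and closing*, arXiv:1504.05286 [Hammond2015SAPJoining], §3.1.6 Definition 3.3 (p. 9 of arXiv v5,
2017): "A plaquette `P` is called a join plaquette of `φ` if `φ` and `P` intersect at precisely the two horizontal edges of
`P`" and the operation `φ Δ P`.
This file supplies the supporting lattice-polygon combinatorics used by the lane's quantitative (explicit-constant) form of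
Madras' bound (venture «pcv-sawmu», route MAD95-2JP, step S3): for the decoding of a join one needs to bound the number of
plaquettes at which a polygon splits into two EQUAL halves.  Statements S3/S3⁺ below are the lane's (a-idea-2, Sketch_v6
v6.2, definitions reproduced verbatim); all proofs are ours.

## Contents (namespace `Literature.Probability.RandomPlanarGeometry.SAW.JoinParity`; 0 sorries)

* definitions `plaqBot/Top/Left/Right`, `plaqFlip` (`γ Δ P`), `IsEqJoinPlaquette`, `rayParity` (upward ray-casting
  parity of a cell), and the statement-Props `RayParityVert`, `RayParityHoriz`, `TransportAlong`, `FlipParityIdentity`,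
  `SidesSplit`, `Interleave`, `EqJoinParityDistinct`, `AtMostTwoEqJoinPlaquettes`, `UniqueInteriorEqNeck`;
* (D1v) `rayParityVert`, (D1h) `rayParityHoriz` (degree-sum along a half-column; polygons have even degrees —
  Mathlib `Walk.IsTrail.even_countP_edges_iff`);
* (L2) `transportAlong`, (L1) `flipParityIdentity`, (L2′) `sidesSplit` with the general `not_isPolygon_subset_erase`
  (a polygon minus an edge contains no polygon), (L3) `interleave`;
* **`eqJoinParityDistinct`**, **`atMostTwoEqJoinPlaquettes`** (a lattice polygon has at most two equal-split join
  plaquettes), **`uniqueInteriorEqNeck`**.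
-/

noncomputable section

open Finset SimpleGraph Literature.Probability.LatticeModels Literature.Probability.Percolation
open Literature.Probability.Percolation.SiteGadgetSystem (vertsOf mem_vertsOf)
open Literature.Probability.RandomPlanarGeometry.SAW

namespace Literature.Probability.RandomPlanarGeometry.SAW.JoinParity

/-! ### Definitions (verbatim from the lane's Sketch_v6.lean v6.2, a-idea-2) -/

/-- bottom side of the unit plaquette with lower-left corner `v`. 
[cite: Hammond2015SAPJoining, §3.1.6 Definition 3.3, p. 9 (join plaquette, γ Δ P; arXiv v5)] -/
def plaqBot (v : Site 2) : Sym2 (Site 2) := s(v, v + ex)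
/-- top side. 
[cite: Hammond2015SAPJoining, §3.1.6 Definition 3.3, p. 9 (join plaquette, γ Δ P; arXiv v5)] -/
def plaqTop (v : Site 2) : Sym2 (Site 2) := s(v + ey, v + ey + ex)
/-- left side. 
[cite: Hammond2015SAPJoining, §3.1.6 Definition 3.3, p. 9 (join plaquette, γ Δ P; arXiv v5)] -/
def plaqLeft (v : Site 2) : Sym2 (Site 2) := s(v, v + ey)
/-- right side. 
[cite: Hammond2015SAPJoining, §3.1.6 Definition 3.3, p. 9 (join plaquette, γ Δ P; arXiv v5)] -/
def plaqRight (v : Site 2) : Sym2 (Site 2) := s(v + ex, v + ex + ey)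

/-- `E Δ P(v)` when `P(v)` meets `E` in exactly its two horizontal sides. 
[cite: Hammond2015SAPJoining, §3.1.6 Definition 3.3, p. 9 (join plaquette, γ Δ P; arXiv v5)] -/
def plaqFlip (E : Finset (Sym2 (Site 2))) (v : Site 2) : Finset (Sym2 (Site 2)) :=
  ((E.erase (plaqBot v)).erase (plaqTop v)) ∪ {plaqLeft v, plaqRight v}

/-- `P(v)` is a join plaquette of the polygon `E` (Hammond: `E ∩ P` = the two horizontal sides of `P`)
whose flip `E Δ P` is the disjoint union of two (vertex-disjoint) polygons OF EQUAL LENGTH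
(= the two horizontal sides are antipodal on the cycle `E`). 
[cite: Hammond2015SAPJoining, §3.1.6 Definition 3.3, p. 9 (join plaquette, γ Δ P; arXiv v5)] -/
def IsEqJoinPlaquette (E : Finset (Sym2 (Site 2))) (v : Site 2) : Prop :=
  plaqBot v ∈ E ∧ plaqTop v ∈ E ∧ plaqLeft v ∉ E ∧ plaqRight v ∉ E ∧
  ∃ E₁ E₂ : Finset (Sym2 (Site 2)), IsPolygon (zdGraph 2) E₁ ∧ IsPolygon (zdGraph 2) E₂ ∧
    Disjoint (vertsOf E₁) (vertsOf E₂) ∧ E₁ ∪ E₂ = plaqFlip E v ∧ E₁.card = E₂.card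

/-- **S3 («2JP lemma», NEW): a self-avoiding polygon of `ℤ²` has AT MOST TWO equal-split join
plaquettes** (and two of them are of opposite traversal type). Blueprint ROUTES §33.4. 
[cite: Madras1995LatticeAnimalsExponent, §2 (joining polygons across a plaquette; supporting lemma for the explicit form)] -/
def AtMostTwoEqJoinPlaquettes : Prop :=
  ∀ E : Finset (Sym2 (Site 2)), IsPolygon (zdGraph 2) E →
    ∀ v₁ v₂ v₃ : Site 2, v₁ ≠ v₂ → v₁ ≠ v₃ → v₂ ≠ v₃ →
      IsEqJoinPlaquette E v₁ → IsEqJoinPlaquette E v₂ → ¬ IsEqJoinPlaquette E v₃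

open Classical in
/-- number (mod 2) of horizontal edges of `E` in the column of the cell with lower-left corner `c`
strictly above the cell's bottom: the vertical ray cast upward from the cell's centre. 
[cite: Madras1995LatticeAnimalsExponent, §2 (joining polygons across a plaquette; supporting lemma for the explicit form)] -/
def rayParity (E : Finset (Sym2 (Site 2))) (c : Site 2) : ZMod 2 :=
  ((E.filter (fun e => ∃ k : ℤ, c 1 < k ∧ e = s((![c 0, k] : Site 2), ![c 0 + 1, k]))).card : ZMod 2)

/-- (D1v) crossing a horizontal lattice edge flips the parity iff the edge is in `E` [definitional]. 
[cite: Madras1995LatticeAnimalsExponent, §2 (joining polygons across a plaquette; supporting lemma for the explicit form)] -/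
def RayParityVert : Prop :=
  ∀ E : Finset (Sym2 (Site 2)), ∀ c : Site 2,
    rayParity E c = rayParity E (c + ey) + (if plaqTop c ∈ E then 1 else 0)

/-- (D1h) crossing a vertical lattice edge flips the parity iff the edge is in `E` — for EVEN-degree
edge sets, in particular polygons (degree-sum along the half-line `x = c₀+1, y ≥ c₁+1`). 
[cite: Madras1995LatticeAnimalsExponent, §2 (joining polygons across a plaquette; supporting lemma for the explicit form)] -/
def RayParityHoriz : Prop :=
  ∀ E : Finset (Sym2 (Site 2)), IsPolygon (zdGraph 2) E → ∀ c : Site 2,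
    rayParity E (c + ex) = rayParity E c + (if plaqRight c ∈ E then 1 else 0)

/-- (D-transport) if `F` is a polygon vertex-disjoint from `E`, all cells having a side on `F` have
the same `E`-parity (walk along `F`; the edges at a vertex of `F` are not in `E`; crossing an
`F`-edge does not flip `E`-parity since `F ∩ E = ∅`). 
[cite: Madras1995LatticeAnimalsExponent, §2 (joining polygons across a plaquette; supporting lemma for the explicit form)] -/
def TransportAlong : Prop :=
  ∀ E F : Finset (Sym2 (Site 2)), IsPolygon (zdGraph 2) E → IsPolygon (zdGraph 2) F →
    Disjoint (vertsOf E) (vertsOf F) →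
    ∀ c₁ c₂ : Site 2,
      (plaqBot c₁ ∈ F ∨ plaqTop c₁ ∈ F ∨ plaqLeft c₁ ∈ F ∨ plaqRight c₁ ∈ F) →
      (plaqBot c₂ ∈ F ∨ plaqTop c₂ ∈ F ∨ plaqLeft c₂ ∈ F ∨ plaqRight c₂ ∈ F) →
      rayParity E c₁ = rayParity E c₂

/-- (L1) flip parity identity: `π_{E₁}(c) + π_{E₂}(c) = π_E(c) + [c = v]` when `E Δ P(v) = E₁ ⊔ E₂`
(pure finset algebra: the vertical sides never lie on a vertical ray of horizontal edges; `bot`/`top`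
are both counted at `c` strictly below `v` in column `v 0`, exactly `top` at `c = v`, none above). 
[cite: Madras1995LatticeAnimalsExponent, §2 (joining polygons across a plaquette; supporting lemma for the explicit form)] -/
def FlipParityIdentity : Prop :=
  ∀ E E₁ E₂ : Finset (Sym2 (Site 2)), ∀ v c : Site 2,
    plaqBot v ∈ E → plaqTop v ∈ E → E₁ ∪ E₂ = plaqFlip E v → Disjoint (vertsOf E₁) (vertsOf E₂) →
    rayParity E₁ c + rayParity E₂ c = rayParity E c + (if c = v then 1 else 0)

/-- (L2′) a polygon inside `E Δ P(v)` contains a vertical side of `P(v)` (else it is a cycle inside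
`E ∖ {bot}`, and a polygon minus an edge is a path: tree `exists_isPath_erase`). 
[cite: Madras1995LatticeAnimalsExponent, §2 (joining polygons across a plaquette; supporting lemma for the explicit form)] -/
def SidesSplit : Prop :=
  ∀ E E' : Finset (Sym2 (Site 2)), ∀ v : Site 2, IsPolygon (zdGraph 2) E → plaqBot v ∈ E →
    IsPolygon (zdGraph 2) E' → E' ⊆ plaqFlip E v → (plaqLeft v ∈ E' ∨ plaqRight v ∈ E')

/-- (L3) interleaving: if `P(v)` is an equal-split join plaquette of `E` with pieces `E₁, E₂` and `P(v')`,
`v' ≠ v`, is another one, then EACH piece contains a horizontal side of `P(v')` (the pairs `{bot,top}`,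
`{bot',top'}` are antipodal on the cycle, hence interleave; arc-length counting, no geometry). 
[cite: Madras1995LatticeAnimalsExponent, §2 (joining polygons across a plaquette; supporting lemma for the explicit form)] -/
def Interleave : Prop :=
  ∀ E : Finset (Sym2 (Site 2)), IsPolygon (zdGraph 2) E → ∀ v v' : Site 2, v ≠ v' →
    IsEqJoinPlaquette E v' →
    ∀ E₁ E₂ : Finset (Sym2 (Site 2)), IsPolygon (zdGraph 2) E₁ → IsPolygon (zdGraph 2) E₂ →
      Disjoint (vertsOf E₁) (vertsOf E₂) → E₁ ∪ E₂ = plaqFlip E v → E₁.card = E₂.card →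
      plaqBot v ∈ E → plaqTop v ∈ E → plaqLeft v ∉ E → plaqRight v ∉ E →
      (plaqBot v' ∈ E₁ ∨ plaqTop v' ∈ E₁) ∧ (plaqBot v' ∈ E₂ ∨ plaqTop v' ∈ E₂)

/-- **S3 core (PARITY DISTINCTNESS)**: two distinct equal-split join plaquettes of a lattice polygon have
different upward ray parities. 
[cite: Madras1995LatticeAnimalsExponent, §2 (joining polygons across a plaquette; supporting lemma for the explicit form)] -/
def EqJoinParityDistinct : Prop :=
  ∀ E : Finset (Sym2 (Site 2)), IsPolygon (zdGraph 2) E →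
    ∀ v₁ v₂ : Site 2, v₁ ≠ v₂ → IsEqJoinPlaquette E v₁ → IsEqJoinPlaquette E v₂ →
      rayParity E v₁ ≠ rayParity E v₂

/-- **S3⁺ (UNIQUE INTERIOR EQUAL-SPLIT NECK)**: a lattice polygon has at most one equal-split join plaquette
whose cell has odd upward ray parity (i.e. lies inside the polygon). 
[cite: Madras1995LatticeAnimalsExponent, §2 (joining polygons across a plaquette; supporting lemma for the explicit form)] -/
def UniqueInteriorEqNeck : Prop :=
  ∀ E : Finset (Sym2 (Site 2)), IsPolygon (zdGraph 2) E →
    ∀ v₁ v₂ : Site 2, v₁ ≠ v₂ → IsEqJoinPlaquette E v₁ → IsEqJoinPlaquette E v₂ →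
      rayParity E v₁ = 1 → rayParity E v₂ = 1 → False

/-! ### Coordinates -/

/-- (coordinates) [folklore] -/
private theorem site_eq_iff (x y : Site 2) : x = y ↔ x 0 = y 0 ∧ x 1 = y 1 :=
  ⟨fun h => by rw [h]; exact ⟨rfl, rfl⟩, fun h => by funext i; fin_cases i <;> simp [h.1, h.2]⟩

/-- (coordinates) [folklore] -/
@[simp] private theorem add_ex_zero (v : Site 2) : (v + ex) 0 = v 0 + 1 := by simp
/-- (coordinates) [folklore] -/
@[simp] private theorem add_ex_one (v : Site 2) : (v + ex) 1 = v 1 := by simp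
/-- (coordinates) [folklore] -/
@[simp] private theorem add_ey_zero (v : Site 2) : (v + ey) 0 = v 0 := by simp
/-- (coordinates) [folklore] -/
@[simp] private theorem add_ey_one (v : Site 2) : (v + ey) 1 = v 1 + 1 := by simp
/-- (coordinates) [folklore] -/
@[simp] private theorem vec_zero' (a b : ℤ) : (![a, b] : Site 2) 0 = a := rfl
/-- (coordinates) [folklore] -/
@[simp] private theorem vec_one' (a b : ℤ) : (![a, b] : Site 2) 1 = b := rfl

/-- The horizontal edge at height `k` in column `a`: `s((a,k),(a+1,k))`. [folklore] -/
def hEdge (a k : ℤ) : Sym2 (Site 2) := s((![a, k] : Site 2), ![a + 1, k])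

/-- The vertical edge in column `a` from height `k` to `k+1`. [folklore] -/
def vEdge (a k : ℤ) : Sym2 (Site 2) := s((![a, k] : Site 2), ![a, k + 1])

/-- (plumbing) [folklore] -/
private theorem hEdge_inj {a k a' k' : ℤ} (h : hEdge a k = hEdge a' k') : a = a' ∧ k = k' := by
  unfold hEdge at h
  rcases Sym2.eq_iff.1 h with ⟨h1, _⟩ | ⟨h1, h2⟩
  · exact ⟨by simpa using congrFun h1 0, by simpa using congrFun h1 1⟩
  · have e1 := congrFun h1 0; have e2 := congrFun h2 0
    simp at e1 e2; omega

/-- (plumbing) [folklore] -/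
private theorem vEdge_inj {a k a' k' : ℤ} (h : vEdge a k = vEdge a' k') : a = a' ∧ k = k' := by
  unfold vEdge at h
  rcases Sym2.eq_iff.1 h with ⟨h1, _⟩ | ⟨h1, h2⟩
  · exact ⟨by simpa using congrFun h1 0, by simpa using congrFun h1 1⟩
  · have e1 := congrFun h1 1; have e2 := congrFun h2 1
    simp at e1 e2; omega

/-- (plumbing) [folklore] -/
private theorem hEdge_ne_vEdge (a k a' k' : ℤ) : hEdge a k ≠ vEdge a' k' := by
  intro h
  unfold hEdge vEdge at h
  rcases Sym2.eq_iff.1 h with ⟨h1, h2⟩ | ⟨h1, h2⟩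
  · have e1 := congrFun h1 0; have e2 := congrFun h2 0
    simp at e1 e2; omega
  · have e1 := congrFun h1 0; have e2 := congrFun h2 0
    simp at e1 e2; omega

/-- (plumbing) [folklore] -/
private theorem plaqTop_eq (c : Site 2) : plaqTop c = hEdge (c 0) (c 1 + 1) := by
  unfold plaqTop hEdge
  congr 1 <;> funext i <;> fin_cases i <;> simp

/-- (plumbing) [folklore] -/
private theorem plaqBot_eq (c : Site 2) : plaqBot c = hEdge (c 0) (c 1) := by
  unfold plaqBot hEdge
  congr 1 <;> funext i <;> fin_cases i <;> simp

/-- (plumbing) [folklore] -/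
private theorem plaqRight_eq (c : Site 2) : plaqRight c = vEdge (c 0 + 1) (c 1) := by
  unfold plaqRight vEdge
  congr 1 <;> funext i <;> fin_cases i <;> simp

/-- (plumbing) [folklore] -/
private theorem plaqLeft_eq (c : Site 2) : plaqLeft c = vEdge (c 0) (c 1) := by
  unfold plaqLeft vEdge
  congr 1 <;> funext i <;> fin_cases i <;> simp

/-- Every lattice edge of `ℤ²` is an `hEdge` or a `vEdge`. [folklore] -/
private theorem edge_cases {x y : Site 2} (h : (zdGraph 2).Adj x y) :
    (∃ a k, s(x, y) = hEdge a k) ∨ (∃ a k, s(x, y) = vEdge a k) := by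
  rw [zdGraph_adj_iff] at h
  obtain ⟨i, h | h⟩ := h
  · fin_cases i
    · left; refine ⟨x 0, x 1, ?_⟩; unfold hEdge; rw [h]
      congr 1 <;> funext j <;> fin_cases j <;> simp
    · right; refine ⟨x 0, x 1, ?_⟩; unfold vEdge; rw [h]
      congr 1 <;> funext j <;> fin_cases j <;> simp
  · fin_cases i
    · left; refine ⟨y 0, y 1, ?_⟩; unfold hEdge; rw [h, Sym2.eq_swap]
      congr 1 <;> funext j <;> fin_cases j <;> simp
    · right; refine ⟨y 0, y 1, ?_⟩; unfold vEdge; rw [h, Sym2.eq_swap]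
      congr 1 <;> funext j <;> fin_cases j <;> simp

/-! ### The ray filter -/

section Ray
open Classical

/-- The set counted by `rayParity E c`: horizontal edges of `E` in column `c 0` strictly above height `c 1`. [folklore] -/
private theorem rayParity_eq (E : Finset (Sym2 (Site 2))) (c : Site 2) :
    rayParity E c = ((E.filter fun e => ∃ k : ℤ, c 1 < k ∧ e = hEdge (c 0) k).card : ZMod 2) := by
  unfold rayParity hEdge; rfl

/-- **(D1v)**, proved. 
[cite: Madras1995LatticeAnimalsExponent, §2 (joining polygons across a plaquette; supporting lemma for the explicit form)] -/
theorem rayParityVert : RayParityVert := by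
  intro E c
  rw [rayParity_eq, rayParity_eq, add_ey_zero, add_ey_one, plaqTop_eq]
  have hsplit : (E.filter fun e => ∃ k : ℤ, c 1 < k ∧ e = hEdge (c 0) k) =
      (E.filter fun e => ∃ k : ℤ, c 1 + 1 < k ∧ e = hEdge (c 0) k) ∪ (E.filter fun e => e = hEdge (c 0) (c 1 + 1)) := by
    rw [← Finset.filter_or]
    refine Finset.filter_congr fun e _ => ⟨?_, ?_⟩
    · rintro ⟨k, hk, rfl⟩
      rcases lt_or_eq_of_le (show c 1 + 1 ≤ k by omega) with h | h
      · exact Or.inl ⟨k, h, rfl⟩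
      · exact Or.inr (by rw [h])
    · rintro (⟨k, hk, rfl⟩ | rfl)
      · exact ⟨k, by omega, rfl⟩
      · exact ⟨c 1 + 1, by omega, rfl⟩
  have hdisj : Disjoint (E.filter fun e => ∃ k : ℤ, c 1 + 1 < k ∧ e = hEdge (c 0) k)
      (E.filter fun e => e = hEdge (c 0) (c 1 + 1)) := by
    rw [Finset.disjoint_filter]
    rintro e _ ⟨k, hk, rfl⟩ h
    have := (hEdge_inj h).2; omega
  rw [hsplit, Finset.card_union_of_disjoint hdisj, Nat.cast_add]
  congr 1
  by_cases h : hEdge (c 0) (c 1 + 1) ∈ E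
  · rw [if_pos h]
    have : (E.filter fun e => e = hEdge (c 0) (c 1 + 1)) = {hEdge (c 0) (c 1 + 1)} := by
      ext e; simp only [Finset.mem_filter, Finset.mem_singleton]
      exact ⟨fun h' => h'.2, fun h' => ⟨h' ▸ h, h'⟩⟩
    rw [this, Finset.card_singleton]; rfl
  · rw [if_neg h]
    have : (E.filter fun e => e = hEdge (c 0) (c 1 + 1)) = ∅ := by
      rw [Finset.filter_eq_empty_iff]; rintro e he rfl; exact h he
    rw [this, Finset.card_empty]; rfl

end Ray

/-! ### (D1h): the degree-sum along a half-column -/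

section Horiz
open Classical

variable {E : Finset (Sym2 (Site 2))}

/-- In a polygon every vertex lies on an even number of edges. 
[cite: MadrasSlade1993, Definition 3.2.1 (a polygon is a cycle: every site has even degree)] -/
theorem even_card_filter_mem (hE : IsPolygon (zdGraph 2) E) (x : Site 2) :
    Even ((E.filter fun e => x ∈ e).card) := by
  obtain ⟨u, c, hc, rfl⟩ := hE
  have h := (hc.isCircuit.isTrail.even_countP_edges_iff x).2 (fun h => (h rfl).elim)
  have hnd : c.edges.Nodup := hc.isCircuit.isTrail.edges_nodup
  rw [List.countP_eq_length_filter, ← List.toFinset_card_of_nodup (hnd.filter _), List.toFinset_filter] at h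
  simpa using h

/-- Endpoint count of an edge on the open half-column `{(a, k) : k > b}`. [folklore] -/
def halfCount (a b : ℤ) (e : Sym2 (Site 2)) : ℕ :=
  ((e.toFinset).filter fun x : Site 2 => x 0 = a ∧ b < x 1).card

/-- (plumbing) [folklore] -/
private theorem halfCount_hEdge (a b a' k : ℤ) :
    halfCount a b (hEdge a' k) = (if b < k ∧ (a' = a ∨ a' + 1 = a) then 1 else 0) := by
  unfold halfCount hEdge
  have hne : (![a', k] : Site 2) ≠ ![a' + 1, k] := by
    intro h; have := congrFun h 0; simp at this
  have ht : (s((![a', k] : Site 2), ![a' + 1, k])).toFinset = {(![a', k] : Site 2), ![a' + 1, k]} := by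
    ext x; simp [Sym2.mem_toFinset]
  rw [ht, Finset.filter_insert, Finset.filter_singleton]
  simp only [vec_zero', vec_one']
  by_cases hk : b < k
  · by_cases h1 : a' = a
    · have h2 : ¬ (a' + 1 = a) := by omega
      simp [hk, h1]
    · by_cases h2 : a' + 1 = a
      · simp [hk, h1, h2]
      · simp [hk, h1, h2]
  · simp [hk]

/-- (plumbing) [folklore] -/
private theorem halfCount_vEdge (a b a' k : ℤ) :
    halfCount a b (vEdge a' k) =
      (if a' = a then ((if b < k then 1 else 0) + (if b < k + 1 then 1 else 0)) else 0) := by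
  unfold halfCount vEdge
  have hne : (![a', k] : Site 2) ≠ ![a', k + 1] := by
    intro h; have := congrFun h 1; simp at this
  have ht : (s((![a', k] : Site 2), ![a', k + 1])).toFinset = {(![a', k] : Site 2), ![a', k + 1]} := by
    ext x; simp [Sym2.mem_toFinset]
  rw [ht, Finset.filter_insert, Finset.filter_singleton]
  simp only [vec_zero', vec_one']
  by_cases h1 : a' = a
  · by_cases hk : b < k
    · have hk' : b < k + 1 := by omega
      simp [h1, hk, hk']
    · by_cases hk' : b < k + 1
      · simp [h1, hk, hk']
      · simp [h1, hk, hk']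
  · simp [h1]

/-- Double counting: `Σ_{e ∈ E} halfCount = Σ_{x ∈ half-column ∩ verts} deg(x)`, hence even for a polygon. [folklore] -/
private theorem even_sum_halfCount (hE : IsPolygon (zdGraph 2) E) (a b : ℤ) :
    Even (∑ e ∈ E, halfCount a b e) := by
  set S : Finset (Site 2) := (vertsOf E).filter fun x => x 0 = a ∧ b < x 1 with hS
  have h1 : ∀ e ∈ E, halfCount a b e = (S.filter fun x => x ∈ e).card := by
    intro e he
    unfold halfCount
    congr 1
    ext x
    simp only [Finset.mem_filter, Sym2.mem_toFinset, hS, mem_vertsOf]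
    constructor
    · rintro ⟨hx, hq⟩; exact ⟨⟨⟨e, he, hx⟩, hq⟩, hx⟩
    · rintro ⟨⟨-, hq⟩, hx⟩; exact ⟨hx, hq⟩
  have h2 : ∑ e ∈ E, halfCount a b e = ∑ x ∈ S, (E.filter fun e => x ∈ e).card := by
    calc ∑ e ∈ E, halfCount a b e = ∑ e ∈ E, (S.filter fun x => x ∈ e).card := Finset.sum_congr rfl h1
      _ = ∑ e ∈ E, ∑ x ∈ S, (if x ∈ e then 1 else 0) := by simp_rw [Finset.card_filter]
      _ = ∑ x ∈ S, ∑ e ∈ E, (if x ∈ e then 1 else 0) := Finset.sum_comm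
      _ = ∑ x ∈ S, (E.filter fun e => x ∈ e).card := by simp_rw [Finset.card_filter]
  rw [h2]
  exact Finset.even_sum _ fun x _ => even_card_filter_mem hE x

/-- **(D1h)**, proved: for a polygon, crossing the vertical edge `plaqRight c` flips the ray parity iff it is in `E`. 
[cite: Madras1995LatticeAnimalsExponent, §2 (joining polygons across a plaquette; supporting lemma for the explicit form)] -/
theorem rayParityHoriz : RayParityHoriz := by
  intro E hE c
  have hadj : ∀ e ∈ E, ∃ x y : Site 2, (zdGraph 2).Adj x y ∧ e = s(x, y) := by
    intro e he
    induction e using Sym2.ind with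
    | _ x y => exact ⟨x, y, hE.mem_edgeSet he, rfl⟩
  -- the three disjoint pieces of `E` with odd `halfCount (c 0 + 1) (c 1)`
  set a : ℤ := c 0 + 1 with ha
  set b : ℤ := c 1 with hb
  set L := E.filter fun e => ∃ k : ℤ, b < k ∧ e = hEdge (c 0) k with hL
  set R := E.filter fun e => ∃ k : ℤ, b < k ∧ e = hEdge a k with hR
  set V := E.filter fun e => e = vEdge a b with hV
  have hparity : ∀ e ∈ E, (halfCount a b e : ZMod 2) =
      (if e ∈ L then 1 else 0) + (if e ∈ R then 1 else 0) + (if e ∈ V then 1 else 0) := by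
    intro e he
    obtain ⟨x, y, hxy, rfl⟩ := hadj e he
    rcases edge_cases hxy with ⟨a', k, h⟩ | ⟨a', k, h⟩
    · rw [h, halfCount_hEdge]
      have hnV : hEdge a' k ∉ V := by
        rw [hV, Finset.mem_filter]; exact fun h' => hEdge_ne_vEdge _ _ _ _ h'.2
      have hLiff : hEdge a' k ∈ L ↔ b < k ∧ a' + 1 = a := by
        rw [hL, Finset.mem_filter]
        constructor
        · rintro ⟨-, k', hk', h'⟩; obtain ⟨h1, h2⟩ := hEdge_inj h'; exact ⟨h2 ▸ hk', by omega⟩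
        · rintro ⟨hk, ha'⟩; exact ⟨h ▸ he, k, hk, by rw [show a' = c 0 by omega]⟩
      have hRiff : hEdge a' k ∈ R ↔ b < k ∧ a' = a := by
        rw [hR, Finset.mem_filter]
        constructor
        · rintro ⟨-, k', hk', h'⟩; obtain ⟨h1, h2⟩ := hEdge_inj h'; exact ⟨h2 ▸ hk', h1⟩
        · rintro ⟨hk, ha'⟩; exact ⟨h ▸ he, k, hk, by rw [ha']⟩
      rw [if_neg hnV, add_zero]
      by_cases hk : b < k
      · by_cases h1 : a' = a
        · have h2 : ¬ (a' + 1 = a) := by omega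
          rw [if_pos ⟨hk, Or.inl h1⟩, if_neg (by rw [hLiff]; tauto), if_pos (hRiff.2 ⟨hk, h1⟩)]; simp
        · by_cases h2 : a' + 1 = a
          · rw [if_pos ⟨hk, Or.inr h2⟩, if_pos (hLiff.2 ⟨hk, h2⟩), if_neg (by rw [hRiff]; tauto)]; simp
          · rw [if_neg (by tauto), if_neg (by rw [hLiff]; tauto), if_neg (by rw [hRiff]; tauto)]; simp
      · rw [if_neg (by tauto), if_neg (by rw [hLiff]; tauto), if_neg (by rw [hRiff]; tauto)]; simp
    · rw [h, halfCount_vEdge]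
      have hnL : vEdge a' k ∉ L := by
        rw [hL, Finset.mem_filter]; rintro ⟨-, k', -, h'⟩; exact hEdge_ne_vEdge _ _ _ _ h'.symm
      have hnR : vEdge a' k ∉ R := by
        rw [hR, Finset.mem_filter]; rintro ⟨-, k', -, h'⟩; exact hEdge_ne_vEdge _ _ _ _ h'.symm
      have hViff : vEdge a' k ∈ V ↔ a' = a ∧ k = b := by
        rw [hV, Finset.mem_filter]
        constructor
        · rintro ⟨-, h'⟩; exact vEdge_inj h'
        · rintro ⟨rfl, rfl⟩; exact ⟨h ▸ he, rfl⟩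
      rw [if_neg hnL, if_neg hnR, zero_add, zero_add]
      by_cases h1 : a' = a
      · rw [if_pos h1]
        by_cases hk : b < k
        · have hk' : b < k + 1 := by omega
          rw [if_pos hk, if_pos hk', if_neg (by rw [hViff]; omega)]; decide
        · by_cases hk' : b < k + 1
          · have : k = b := by omega
            rw [if_neg hk, if_pos hk', if_pos (hViff.2 ⟨h1, this⟩)]; simp
          · rw [if_neg hk, if_neg hk', if_neg (by rw [hViff]; omega)]; simp
      · rw [if_neg h1, if_neg (by rw [hViff]; tauto)]; simp
  -- sum over `E`
  have hsum : (∑ e ∈ E, (halfCount a b e : ZMod 2)) = (L.card : ZMod 2) + R.card + V.card := by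
    rw [Finset.sum_congr rfl hparity, Finset.sum_add_distrib, Finset.sum_add_distrib]
    rw [← Finset.sum_filter, ← Finset.sum_filter, ← Finset.sum_filter]
    have eL : (E.filter fun e => e ∈ L) = L := by
      ext e; rw [Finset.mem_filter, hL, Finset.mem_filter]; tauto
    have eR : (E.filter fun e => e ∈ R) = R := by
      ext e; rw [Finset.mem_filter, hR, Finset.mem_filter]; tauto
    have eV : (E.filter fun e => e ∈ V) = V := by
      ext e; rw [Finset.mem_filter, hV, Finset.mem_filter]; tauto
    rw [eL, eR, eV]
    simp [Finset.sum_const]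
  have heven := even_sum_halfCount hE a b
  have h0 : (∑ e ∈ E, (halfCount a b e : ZMod 2)) = 0 := by
    rw [← Nat.cast_sum]; exact (ZMod.natCast_eq_zero_iff_even).2 heven |>.symm ▸ rfl
  -- identify the pieces with the ray parities
  have hLp : rayParity E c = (L.card : ZMod 2) := by rw [rayParity_eq]
  have hRp : rayParity E (c + ex) = (R.card : ZMod 2) := by rw [rayParity_eq, add_ex_zero, add_ex_one]
  have hVp : (if plaqRight c ∈ E then (1 : ZMod 2) else 0) = (V.card : ZMod 2) := by
    rw [plaqRight_eq]
    by_cases h : vEdge (c 0 + 1) (c 1) ∈ E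
    · rw [if_pos h]
      have : V = {vEdge a b} := by
        ext e; rw [hV, Finset.mem_filter, Finset.mem_singleton]
        exact ⟨fun h' => h'.2, fun h' => ⟨h' ▸ h, h'⟩⟩
      rw [this, Finset.card_singleton]; rfl
    · rw [if_neg h]
      have : V = ∅ := by rw [hV, Finset.filter_eq_empty_iff]; rintro e he rfl; exact h he
      rw [this, Finset.card_empty]; rfl
  rw [hLp, hRp, hVp]
  rw [hsum] at h0
  -- in characteristic two, `L + R + V = 0` gives `R = L + V`
  have key : ∀ x y z : ZMod 2, x + y + z = 0 → y = x + z := by decide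
  exact key _ _ _ h0

end Horiz

/-! ### (L2) Transport along a vertex-disjoint polygon -/

section Transport
open Classical

variable {E : Finset (Sym2 (Site 2))}

/-- (plumbing) [folklore] -/
private theorem not_mem_of_mem_edge {x : Site 2} (hx : x ∉ vertsOf E) {e : Sym2 (Site 2)} (hxe : x ∈ e) : e ∉ E :=
  fun he => hx (mem_vertsOf.2 ⟨e, he, hxe⟩)

/-- (T1) the four cells around a vertex `x` not on `E` have the same `E`-parity. [folklore] -/
private theorem parity_around (hE : IsPolygon (zdGraph 2) E) {x : Site 2} (hx : x ∉ vertsOf E) :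
    rayParity E (x - ex) = rayParity E x ∧ rayParity E (x - ey) = rayParity E x ∧
      rayParity E (x - ex - ey) = rayParity E x := by
  have hV := rayParityVert E
  have hH := rayParityHoriz E hE
  -- left neighbour cell `x - ex`: cross the vertical edge `s(x, x + ey)`
  have h1 : rayParity E (x - ex) = rayParity E x := by
    have h := hH (x - ex)
    rw [sub_add_cancel] at h
    have hn : plaqRight (x - ex) ∉ E := not_mem_of_mem_edge hx (by
      unfold plaqRight; rw [sub_add_cancel]; exact Sym2.mem_mk_left _ _)
    rw [if_neg hn, add_zero] at h
    exact h.symm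
  -- lower cell `x - ey`: cross the horizontal edge `s(x, x + ex)`
  have h2 : rayParity E (x - ey) = rayParity E x := by
    have h := hV (x - ey)
    rw [sub_add_cancel] at h
    have hn : plaqTop (x - ey) ∉ E := not_mem_of_mem_edge hx (by
      unfold plaqTop; rw [sub_add_cancel]; exact Sym2.mem_mk_left _ _)
    rw [if_neg hn, add_zero] at h
    exact h
  -- lower-left cell `x - ex - ey`: cross the horizontal edge `s(x - ex, x)` to reach `x - ex`
  have h3 : rayParity E (x - ex - ey) = rayParity E (x - ex) := by
    have h := hV (x - ex - ey)
    rw [sub_add_cancel] at h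
    have hn : plaqTop (x - ex - ey) ∉ E := not_mem_of_mem_edge hx (by
      unfold plaqTop; rw [sub_add_cancel, sub_add_cancel]; exact Sym2.mem_mk_right _ _)
    rw [if_neg hn, add_zero] at h
    exact h
  exact ⟨h1, h2, h3.trans h1⟩

/-- (T3) lattice-adjacent vertices off `E` have cells of equal `E`-parity. [folklore] -/
private theorem parity_adj (hE : IsPolygon (zdGraph 2) E) {x y : Site 2} (hxy : (zdGraph 2).Adj x y)
    (hx : x ∉ vertsOf E) (hy : y ∉ vertsOf E) : rayParity E x = rayParity E y := by
  have key : ∀ {p q : Site 2}, q ∉ vertsOf E → (∃ i : Fin 2, q = p + Pi.single i 1) →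
      rayParity E p = rayParity E q := by
    rintro p q hq ⟨i, rfl⟩
    have hi : (Pi.single i (1 : ℤ) : Site 2) = ex ∨ (Pi.single i (1 : ℤ) : Site 2) = ey := by
      fin_cases i
      · exact Or.inl rfl
      · exact Or.inr rfl
    rcases hi with h | h <;> rw [h] at hq ⊢
    · have h1 := (parity_around hE hq).1
      rw [add_sub_cancel_right] at h1; exact h1
    · have h2 := (parity_around hE hq).2.1
      rw [add_sub_cancel_right] at h2; exact h2
  rw [zdGraph_adj_iff] at hxy
  obtain ⟨i, h | h⟩ := hxy
  · exact key hy ⟨i, h⟩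
  · exact (key hx ⟨i, h⟩).symm

/-- (T4) along a walk avoiding `vertsOf E` the cell parity is constant. [folklore] -/
private theorem parity_walk (hE : IsPolygon (zdGraph 2) E) {u v : Site 2} (p : (zdGraph 2).Walk u v)
    (hp : ∀ x ∈ p.support, x ∉ vertsOf E) : ∀ x ∈ p.support, rayParity E x = rayParity E v := by
  induction p with
  | nil => intro x hx; rw [Walk.support_nil, List.mem_singleton] at hx; rw [hx]
  | cons h p ih =>
    rename_i a b c
    have hb : b ∈ (Walk.cons h p).support := by rw [Walk.support_cons]; exact List.mem_cons_of_mem _ p.start_mem_support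
    have ih' := ih (fun x hx => hp x (by rw [Walk.support_cons]; exact List.mem_cons_of_mem _ hx))
    intro x hx
    rw [Walk.support_cons, List.mem_cons] at hx
    rcases hx with rfl | hx
    · rw [parity_adj hE h (hp _ (Walk.start_mem_support _)) (hp b hb)]
      exact ih' b p.start_mem_support
    · exact ih' x hx

/-- (T2) a cell with a side on `F` has the `E`-parity of a cell cornered at a vertex of `F`. [folklore] -/
private theorem parity_of_side (hE : IsPolygon (zdGraph 2) E) {F : Finset (Sym2 (Site 2))}
    (hdis : Disjoint (vertsOf E) (vertsOf F)) {c : Site 2}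
    (hc : plaqBot c ∈ F ∨ plaqTop c ∈ F ∨ plaqLeft c ∈ F ∨ plaqRight c ∈ F) :
    ∃ x ∈ vertsOf F, rayParity E c = rayParity E x := by
  have hxE : ∀ {x}, x ∈ vertsOf F → x ∉ vertsOf E := fun hx hx' => Finset.disjoint_left.1 hdis hx' hx
  rcases hc with h | h | h | h
  · exact ⟨c, mem_vertsOf.2 ⟨_, h, by unfold plaqBot; exact Sym2.mem_mk_left _ _⟩, rfl⟩
  · have hx : c + ey ∈ vertsOf F := mem_vertsOf.2 ⟨_, h, by unfold plaqTop; exact Sym2.mem_mk_left _ _⟩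
    refine ⟨c + ey, hx, ?_⟩
    have := (parity_around hE (hxE hx)).2.1
    rw [add_sub_cancel_right] at this
    exact this
  · exact ⟨c, mem_vertsOf.2 ⟨_, h, by unfold plaqLeft; exact Sym2.mem_mk_left _ _⟩, rfl⟩
  · have hx : c + ex ∈ vertsOf F := mem_vertsOf.2 ⟨_, h, by unfold plaqRight; exact Sym2.mem_mk_left _ _⟩
    refine ⟨c + ex, hx, ?_⟩
    have := (parity_around hE (hxE hx)).1
    rw [add_sub_cancel_right] at this
    exact this

/-- **(L2) `TransportAlong`**, proved. 
[cite: Madras1995LatticeAnimalsExponent, §2 (joining polygons across a plaquette; supporting lemma for the explicit form)] -/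
theorem transportAlong : TransportAlong := by
  intro E F hE hF hdis c₁ c₂ hc₁ hc₂
  have hxE : ∀ {x}, x ∈ vertsOf F → x ∉ vertsOf E := fun hx hx' => Finset.disjoint_left.1 hdis hx' hx
  obtain ⟨x₁, hx₁, e₁⟩ := parity_of_side hE hdis hc₁
  obtain ⟨x₂, hx₂, e₂⟩ := parity_of_side hE hdis hc₂
  -- open `F` at an edge and transport along the resulting path
  obtain ⟨e, he, -⟩ := mem_vertsOf.1 hx₁
  obtain ⟨a, b, hab⟩ : ∃ a b : Site 2, e = s(a, b) := by
    induction e using Sym2.ind with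
    | _ a b => exact ⟨a, b, rfl⟩
  subst hab
  obtain ⟨P, -, -, -, -, hPs⟩ := hF.exists_isPath_erase he
  have hsupp : ∀ x ∈ P.support, x ∉ vertsOf E := fun x hx => hxE (mem_vertsOf.2 ((hPs x).1 hx))
  have h₁ := parity_walk hE P hsupp x₁ ((hPs x₁).2 (mem_vertsOf.1 hx₁))
  have h₂ := parity_walk hE P hsupp x₂ ((hPs x₂).2 (mem_vertsOf.1 hx₂))
  rw [e₁, e₂, h₁, h₂]

end Transport

/-! ### (L1) The flip parity identity -/

section Flip
open Classical

/-- Vertex-disjoint edge sets are disjoint. [folklore] -/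
private theorem disjoint_of_vertsOf_disjoint {E₁ E₂ : Finset (Sym2 (Site 2))} (h : Disjoint (vertsOf E₁) (vertsOf E₂)) :
    Disjoint E₁ E₂ := by
  rw [Finset.disjoint_left]
  intro e h1 h2
  induction e using Sym2.ind with
  | _ a b =>
    exact Finset.disjoint_left.1 h (mem_vertsOf.2 ⟨_, h1, Sym2.mem_mk_left a b⟩) (mem_vertsOf.2 ⟨_, h2, Sym2.mem_mk_left a b⟩)

/-- The ray count is additive over disjoint edge sets. [folklore] -/
private theorem rayParity_union {E₁ E₂ : Finset (Sym2 (Site 2))} (h : Disjoint E₁ E₂) (c : Site 2) :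
    rayParity (E₁ ∪ E₂) c = rayParity E₁ c + rayParity E₂ c := by
  rw [rayParity_eq, rayParity_eq, rayParity_eq, Finset.filter_union,
    Finset.card_union_of_disjoint (Finset.disjoint_filter_filter h), Nat.cast_add]

/-- Erasing a member changes the ray count by its indicator. [folklore] -/
private theorem rayParity_erase {E : Finset (Sym2 (Site 2))} {e : Sym2 (Site 2)} (he : e ∈ E) (c : Site 2) :
    rayParity E c = rayParity (E.erase e) c + (if (∃ k : ℤ, c 1 < k ∧ e = hEdge (c 0) k) then 1 else 0) := by
  rw [rayParity_eq, rayParity_eq, Finset.filter_erase]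
  by_cases h : ∃ k : ℤ, c 1 < k ∧ e = hEdge (c 0) k
  · rw [if_pos h]
    have hmem : e ∈ E.filter fun e => ∃ k : ℤ, c 1 < k ∧ e = hEdge (c 0) k := Finset.mem_filter.2 ⟨he, h⟩
    rw [← Finset.card_erase_add_one hmem, Nat.cast_add, Nat.cast_one]
  · rw [if_neg h, add_zero]
    rw [Finset.erase_eq_of_notMem]
    exact fun h' => h (Finset.mem_filter.1 h').2

/-- Vertical edges are invisible to the ray. [folklore] -/
private theorem rayParity_insert_vEdge (E : Finset (Sym2 (Site 2))) (a k : ℤ) (c : Site 2) :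
    rayParity (insert (vEdge a k) E) c = rayParity E c := by
  rw [rayParity_eq, rayParity_eq, Finset.filter_insert, if_neg]
  rintro ⟨k', -, h⟩
  exact hEdge_ne_vEdge _ _ _ _ h.symm

/-- **(L1) `FlipParityIdentity`**, proved. 
[cite: Madras1995LatticeAnimalsExponent, §2 (joining polygons across a plaquette; supporting lemma for the explicit form)] -/
theorem flipParityIdentity : FlipParityIdentity := by
  intro E E₁ E₂ v c hb ht hU hdis
  have hne : plaqBot v ≠ plaqTop v := by
    rw [plaqBot_eq, plaqTop_eq]; intro h; have := (hEdge_inj h).2; omega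
  have htop' : plaqTop v ∈ E.erase (plaqBot v) := Finset.mem_erase.2 ⟨hne.symm, ht⟩
  -- left side: `π₁ + π₂ = π(plaqFlip) = π((E − bot) − top)`
  have hflip : plaqFlip E v = insert (plaqLeft v) (insert (plaqRight v) ((E.erase (plaqBot v)).erase (plaqTop v))) := by
    unfold plaqFlip; ext e
    simp only [Finset.mem_union, Finset.mem_insert, Finset.mem_singleton]
    tauto
  have h1 : rayParity E₁ c + rayParity E₂ c = rayParity ((E.erase (plaqBot v)).erase (plaqTop v)) c := by
    rw [← rayParity_union (disjoint_of_vertsOf_disjoint hdis), hU, hflip, plaqLeft_eq, plaqRight_eq,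
      rayParity_insert_vEdge, rayParity_insert_vEdge]
  -- right side: erase `bot` then `top`
  have h2 := rayParity_erase hb c
  have h3 := rayParity_erase htop' c
  rw [h1, h2, h3, plaqBot_eq, plaqTop_eq]
  -- the indicator arithmetic in `ZMod 2`
  have ib : (∃ k : ℤ, c 1 < k ∧ hEdge (v 0) (v 1) = hEdge (c 0) k) ↔ (c 0 = v 0 ∧ c 1 < v 1) := by
    constructor
    · rintro ⟨k, hk, h⟩; obtain ⟨h1, h2⟩ := hEdge_inj h; exact ⟨h1.symm, h2 ▸ hk⟩
    · rintro ⟨h0, h1⟩; exact ⟨v 1, h1, by rw [h0]⟩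
  have it : (∃ k : ℤ, c 1 < k ∧ hEdge (v 0) (v 1 + 1) = hEdge (c 0) k) ↔ (c 0 = v 0 ∧ c 1 < v 1 + 1) := by
    constructor
    · rintro ⟨k, hk, h⟩; obtain ⟨h1, h2⟩ := hEdge_inj h; exact ⟨h1.symm, h2 ▸ hk⟩
    · rintro ⟨h0, h1⟩; exact ⟨v 1 + 1, h1, by rw [h0]⟩
  simp only [ib, it]
  have hcv : c = v ↔ c 0 = v 0 ∧ c 1 = v 1 := site_eq_iff c v
  set x := rayParity ((E.erase (hEdge (v 0) (v 1))).erase (hEdge (v 0) (v 1 + 1))) c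
  have k1 : ∀ y : ZMod 2, y = y + 1 + 1 + 0 := by decide
  have k2 : ∀ y : ZMod 2, y = y + 1 + 0 + 1 := by decide
  have k3 : ∀ y : ZMod 2, y = y + 0 + 0 + 0 := by decide
  by_cases h0 : c 0 = v 0
  · rcases lt_trichotomy (c 1) (v 1) with h | h | h
    · rw [if_pos ⟨h0, by omega⟩, if_pos ⟨h0, h⟩, if_neg (by rw [hcv]; omega)]
      exact k1 x
    · rw [if_pos ⟨h0, by omega⟩, if_neg (by rintro ⟨-, h'⟩; omega), if_pos (by rw [hcv]; exact ⟨h0, h⟩)]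
      exact k2 x
    · rw [if_neg (by rintro ⟨-, h'⟩; omega), if_neg (by rintro ⟨-, h'⟩; omega), if_neg (by rw [hcv]; omega)]
      exact k3 x
  · rw [if_neg (by tauto), if_neg (by tauto), if_neg (by rw [hcv]; tauto)]
    exact k3 x

end Flip

/-! ### (L2′) No polygon inside an opened polygon; `SidesSplit` -/

section Sides

/-- The consecutive pairs of a list, by index. [folklore] -/
private theorem mem_pairEdges_iff_getElem {V : Type*} {l : List V} {e : Sym2 V} :
    e ∈ pairEdges l ↔ ∃ (i : ℕ) (h : i + 1 < l.length), e = s(l[i], l[i + 1]) := by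
  induction l with
  | nil => simp
  | cons a l ih =>
    cases l with
    | nil => simp
    | cons b l =>
      rw [pairEdges_cons_cons, List.mem_cons, ih]
      constructor
      · rintro (rfl | ⟨i, hi, rfl⟩)
        · exact ⟨0, by simp, by simp⟩
        · exact ⟨i + 1, by simpa using hi, by simp⟩
      · rintro ⟨i, hi, rfl⟩
        cases i with
        | zero => exact Or.inl (by simp)
        | succ i => exact Or.inr ⟨i, by simpa using hi, by simp⟩

/-- **A polygon minus an edge contains no polygon** (the opened polygon is a self-avoiding list; a vertex of
the would-be sub-polygon of minimal index has both its neighbours at larger index, impossible). 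
[cite: MadrasSlade1993, Definition 3.2.1 (a polygon minus a bond is a self-avoiding walk)] -/
theorem not_isPolygon_subset_erase {V : Type*} [DecidableEq V] {G : SimpleGraph V} {E E' : Finset (Sym2 V)}
    (hE : IsPolygon G E) {a b : V} (hab : s(a, b) ∈ E) (hE' : IsPolygon G E') (hsub : E' ⊆ E.erase s(a, b)) :
    False := by
  classical
  have hspec := openList_spec hE hab
  set l := openList G E a b with hl
  have hnd := hspec.2.1
  have hpe := hspec.2.2.2.2.2.2.1
  have hmem : ∀ e ∈ E', ∃ (i : ℕ) (h : i + 1 < l.length), e = s(l[i], l[i + 1]) := fun e he => by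
    have : e ∈ (pairEdges l).toFinset := by rw [hpe]; exact hsub he
    exact mem_pairEdges_iff_getElem.1 (List.mem_toFinset.1 this)
  have hne' : E'.Nonempty := by
    obtain ⟨u, c, hc, rfl⟩ := hE'
    rw [List.toFinset_nonempty_iff, ne_eq, ← List.length_eq_zero_iff, Walk.length_edges]
    have := hc.three_le_length; omega
  -- indices of vertices of `E'`
  set I := (Finset.range l.length).filter (fun i => ∃ h : i < l.length, ∃ e ∈ E', l[i] ∈ e) with hI
  obtain ⟨e₀, he₀⟩ := hne'
  obtain ⟨i, hi, hie⟩ := hmem e₀ he₀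
  have hiI : i ∈ I := by
    rw [hI, Finset.mem_filter, Finset.mem_range]
    exact ⟨by omega, by omega, e₀, he₀, by rw [hie]; exact Sym2.mem_mk_left _ _⟩
  have hIne : I.Nonempty := ⟨i, hiI⟩
  set i₀ := I.min' hIne with hi₀
  have hi₀I : i₀ ∈ I := Finset.min'_mem I hIne
  rw [hI, Finset.mem_filter] at hi₀I
  obtain ⟨-, h₀, hx⟩ := hi₀I
  have hinj : ∀ {j k : ℕ} (hj : j < l.length) (hk : k < l.length), l[j] = l[k] → j = k :=
    fun hj hk h => (hnd.getElem_inj_iff).1 h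
  -- both polygon-neighbours of `l[i₀]` must be `l[i₀ + 1]`
  have step : ∀ b' : V, s(l[i₀], b') ∈ E' → ∃ h : i₀ + 1 < l.length, b' = l[i₀ + 1] := by
    intro b' hb'
    obtain ⟨k, hk, heq⟩ := hmem _ hb'
    rcases Sym2.eq_iff.1 heq with ⟨h1, h2⟩ | ⟨h1, h2⟩
    · have := hinj h₀ (by omega) h1
      subst this
      exact ⟨hk, h2⟩
    · have hk0 := hinj h₀ hk h1
      -- then `k = i₀ - 1` carries a vertex of `E'`, contradicting minimality
      have hkI : k ∈ I := by
        rw [hI, Finset.mem_filter, Finset.mem_range]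
        exact ⟨by omega, by omega, _, hb', by rw [h2]; exact Sym2.mem_mk_right _ _⟩
      have := Finset.min'_le I k hkI
      omega
  obtain ⟨b₁, b₂, hb, h1, h2, -, -⟩ := hE'.exists_two_edges hx
  obtain ⟨hl1, e1⟩ := step b₁ h1
  obtain ⟨hl2, e2⟩ := step b₂ h2
  exact hb (by rw [e1, e2])

/-- **(L2′) `SidesSplit`**, proved. 
[cite: Madras1995LatticeAnimalsExponent, §2 (joining polygons across a plaquette; supporting lemma for the explicit form)] -/
theorem sidesSplit : SidesSplit := by
  intro E E' v hE hb hE' hsub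
  by_contra h
  push Not at h
  refine not_isPolygon_subset_erase hE (a := v) (b := v + ex) hb hE' fun e he => ?_
  have h' := hsub he
  unfold plaqFlip at h'
  rcases Finset.mem_union.1 h' with h' | h'
  · exact Finset.mem_of_mem_erase h'
  · simp only [Finset.mem_insert, Finset.mem_singleton] at h'
    rcases h' with rfl | rfl
    · exact absurd he h.1
    · exact absurd he h.2

end Sides

/-! ### (L3) Interleaving of two equal-split join plaquettes -/

section Interleave
open Classical

/-- Neighbours in `ℤ²`. [folklore] -/
private theorem adj_cases {p c : Site 2} (h : (zdGraph 2).Adj p c) :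
    c = p + ex ∨ c = p - ex ∨ c = p + ey ∨ c = p - ey := by
  rw [zdGraph_adj_iff] at h
  obtain ⟨i, h | h⟩ := h
  · fin_cases i
    · exact Or.inl h
    · exact Or.inr (Or.inr (Or.inl h))
  · fin_cases i
    · exact Or.inr (Or.inl (by rw [h]; exact (add_sub_cancel_right c _).symm))
    · exact Or.inr (Or.inr (Or.inr (by rw [h]; exact (add_sub_cancel_right c _).symm)))

/-- An edge of a polygon through `p` is `s(p, c)` for a neighbour `c` of `p`. [folklore] -/
private theorem edge_at {E : Finset (Sym2 (Site 2))} (hE : IsPolygon (zdGraph 2) E) {e : Sym2 (Site 2)} (he : e ∈ E)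
    {p : Site 2} (hp : p ∈ e) : ∃ c : Site 2, e = s(p, c) ∧ (zdGraph 2).Adj p c := by
  induction e using Sym2.ind with
  | _ x y =>
    have hadj := hE.mem_edgeSet he
    rcases Sym2.mem_iff.1 hp with rfl | rfl
    · exact ⟨y, rfl, hadj⟩
    · exact ⟨x, Sym2.eq_swap, hadj.symm⟩

/-- Degree count after inserting a new edge. [folklore] -/
private theorem card_filter_insert_of_notMem {A : Finset (Sym2 (Site 2))} {t : Sym2 (Site 2)} (ht : t ∉ A) (x : Site 2) :
    ((insert t A).filter fun e => x ∈ e).card = (A.filter fun e => x ∈ e).card + (if x ∈ t then 1 else 0) := by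
  rw [Finset.filter_insert]
  by_cases h : x ∈ t
  · rw [if_pos h, if_pos h, Finset.card_insert_of_notMem (fun h' => ht (Finset.mem_filter.1 h').1)]
  · rw [if_neg h, if_neg h, add_zero]

/-- (C2) The edges of a walk inside a vertex-disjoint union `F₁ ⊔ F₂` all lie in one piece. [folklore] -/
private theorem walk_edges_one_piece {F₁ F₂ : Finset (Sym2 (Site 2))} (hdis : Disjoint (vertsOf F₁) (vertsOf F₂))
    {a b : Site 2} (P : (zdGraph 2).Walk a b) (hP : ∀ e ∈ P.edges, e ∈ F₁ ∨ e ∈ F₂) :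
    (∀ e ∈ P.edges, e ∈ F₁) ∨ (∀ e ∈ P.edges, e ∈ F₂) := by
  induction P with
  | nil => left; intro e he; simp at he
  | cons h p ih =>
    rename_i u v w
    have ih' := ih (fun e he => hP e (by rw [Walk.edges_cons]; exact List.mem_cons_of_mem _ he))
    have h0 := hP s(u, v) (by rw [Walk.edges_cons]; exact List.mem_cons_self)
    have key : ∀ {A B : Finset (Sym2 (Site 2))}, Disjoint (vertsOf A) (vertsOf B) → s(u, v) ∈ A →
        (∀ e ∈ p.edges, e ∈ B) → ∀ e ∈ (Walk.cons h p).edges, e ∈ A := by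
      intro A B hAB huv hpB
      cases p with
      | nil =>
        intro e he
        rw [Walk.edges_cons, Walk.edges_nil, List.mem_singleton] at he
        rw [he]; exact huv
      | cons h' p' =>
        rename_i w'
        exfalso
        have h1 : s(v, w') ∈ B := hpB _ (by rw [Walk.edges_cons]; exact List.mem_cons_self)
        exact Finset.disjoint_left.1 hAB (mem_vertsOf.2 ⟨_, huv, Sym2.mem_mk_right _ _⟩)
          (mem_vertsOf.2 ⟨_, h1, Sym2.mem_mk_left _ _⟩)
    rcases h0 with h0 | h0
    · rcases ih' with h1 | h1
      · left
        intro e he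
        rw [Walk.edges_cons, List.mem_cons] at he
        rcases he with rfl | he
        · exact h0
        · exact h1 e he
      · exact Or.inl (key hdis h0 h1)
    · rcases ih' with h1 | h1
      · exact Or.inr (key hdis.symm h0 h1)
      · right
        intro e he
        rw [Walk.edges_cons, List.mem_cons] at he
        rcases he with rfl | he
        · exact h0
        · exact h1 e he

/-- `|plaqFlip E v| = |E|` for a plaquette meeting `E` in exactly its two horizontal sides. [folklore] -/
private theorem card_plaqFlip {E : Finset (Sym2 (Site 2))} {v : Site 2} (hb : plaqBot v ∈ E) (ht : plaqTop v ∈ E)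
    (hl : plaqLeft v ∉ E) (hr : plaqRight v ∉ E) : (plaqFlip E v).card = E.card := by
  have hne : plaqBot v ≠ plaqTop v := by
    rw [plaqBot_eq, plaqTop_eq]; intro h; have := (hEdge_inj h).2; omega
  have hne' : plaqLeft v ≠ plaqRight v := by
    rw [plaqLeft_eq, plaqRight_eq]; intro h; have := (vEdge_inj h).1; omega
  have htop' : plaqTop v ∈ E.erase (plaqBot v) := Finset.mem_erase.2 ⟨hne.symm, ht⟩
  unfold plaqFlip
  rw [Finset.card_union_of_disjoint, Finset.card_erase_of_mem htop', Finset.card_erase_of_mem hb,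
    Finset.card_pair hne']
  · have : 2 ≤ E.card := by
      have h1 := Finset.card_pos.2 ⟨_, htop'⟩
      rw [Finset.card_erase_of_mem hb] at h1; omega
    omega
  · rw [Finset.disjoint_left]
    intro e he he'
    simp only [Finset.mem_insert, Finset.mem_singleton] at he'
    have heE : e ∈ E := Finset.mem_of_mem_erase (Finset.mem_of_mem_erase he)
    rcases he' with rfl | rfl
    · exact hl heE
    · exact hr heE

/-- The two pieces of an equal split have half the edges each. [folklore] -/
private theorem two_mul_card_piece {E E₁ E₂ : Finset (Sym2 (Site 2))} {v : Site 2} (hb : plaqBot v ∈ E) (ht : plaqTop v ∈ E)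
    (hl : plaqLeft v ∉ E) (hr : plaqRight v ∉ E) (hdis : Disjoint (vertsOf E₁) (vertsOf E₂))
    (hU : E₁ ∪ E₂ = plaqFlip E v) (hcard : E₁.card = E₂.card) : 2 * E₁.card = E.card := by
  have := Finset.card_union_of_disjoint (disjoint_of_vertsOf_disjoint hdis)
  rw [hU, card_plaqFlip hb ht hl hr] at this
  omega

variable {E : Finset (Sym2 (Site 2))}

/-- One side of **(L3)**: the piece `E₁` contains a horizontal side of the other plaquette. [folklore] -/
private theorem interleave_one (hE : IsPolygon (zdGraph 2) E) {v v' : Site 2} (hne : v ≠ v') (hv' : IsEqJoinPlaquette E v')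
    {E₁ E₂ : Finset (Sym2 (Site 2))} (hP₁ : IsPolygon (zdGraph 2) E₁) (hP₂ : IsPolygon (zdGraph 2) E₂)
    (hdis : Disjoint (vertsOf E₁) (vertsOf E₂)) (hU : E₁ ∪ E₂ = plaqFlip E v) (hcard : E₁.card = E₂.card)
    (hb : plaqBot v ∈ E) (ht : plaqTop v ∈ E) (hl : plaqLeft v ∉ E) (hr : plaqRight v ∉ E) :
    plaqBot v' ∈ E₁ ∨ plaqTop v' ∈ E₁ := by
  by_contra hcon
  push Not at hcon
  obtain ⟨hb1, ht1⟩ := hcon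
  obtain ⟨hb', ht', hl', hr', E₁', E₂', hP₁', hP₂', hdis', hU', hcard'⟩ := hv'
  have hE12 : Disjoint E₁ E₂ := disjoint_of_vertsOf_disjoint hdis
  -- cardinalities
  have hc1 := two_mul_card_piece hb ht hl hr hdis hU hcard
  have hc1' := two_mul_card_piece hb' ht' hl' hr' hdis' hU' hcard'
  -- Step 1: `E₁` contains exactly one vertical side `s₁ = s(p, p + ey)` of `P(v)`, `p ∈ {v, v + ex}`
  have hs1 := sidesSplit E E₁ v hE hb hP₁ (hU ▸ Finset.subset_union_left)
  have hs2 := sidesSplit E E₂ v hE hb hP₂ (hU ▸ Finset.subset_union_right)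
  obtain ⟨p, hpv, hs₁, ht₁⟩ : ∃ p : Site 2, (p = v ∨ p = v + ex) ∧ s(p, p + ey) ∈ E₁ ∧
      ∀ e ∈ E₁, e ≠ s(p, p + ey) → e ∈ (E.erase (plaqBot v)).erase (plaqTop v) := by
    have hmem : ∀ e ∈ E₁, e ∈ (E.erase (plaqBot v)).erase (plaqTop v) ∨ e = plaqLeft v ∨ e = plaqRight v := by
      intro e he
      have h' : e ∈ plaqFlip E v := hU ▸ Finset.mem_union_left _ he
      unfold plaqFlip at h'
      rcases Finset.mem_union.1 h' with h' | h'
      · exact Or.inl h'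
      · simp only [Finset.mem_insert, Finset.mem_singleton] at h'
        rcases h' with h' | h'
        · exact Or.inr (Or.inl h')
        · exact Or.inr (Or.inr h')
    rcases hs1 with h | h
    · refine ⟨v, Or.inl rfl, h, fun e he hne' => ?_⟩
      rcases hmem e he with h' | h' | h'
      · exact h'
      · exact absurd h' hne'
      · -- `right ∈ E₁` too: then `E₂` has no vertical side
        exfalso
        rw [h'] at he
        rcases hs2 with h2 | h2
        · exact Finset.disjoint_left.1 hE12 h h2
        · exact Finset.disjoint_left.1 hE12 he h2
    · refine ⟨v + ex, Or.inr rfl, h, fun e he hne' => ?_⟩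
      rcases hmem e he with h' | h' | h'
      · exact h'
      · exfalso
        rw [h'] at he
        rcases hs2 with h2 | h2
        · exact Finset.disjoint_left.1 hE12 he h2
        · exact Finset.disjoint_left.1 hE12 h h2
      · exact absurd h' hne'
  set s₁ : Sym2 (Site 2) := s(p, p + ey) with hs₁def
  have hs₁E : s₁ ∉ E := by
    rcases hpv with rfl | rfl
    · exact hl
    · exact hr
  -- the arc `A₁ = E₁ − s₁ ⊆ E − {bot, top, bot', top'}`
  set A₁ := E₁.erase s₁ with hA₁
  have hA₁E : ∀ e ∈ A₁, e ∈ E ∧ e ≠ plaqBot v' ∧ e ≠ plaqTop v' := by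
    intro e he
    obtain ⟨hne', he₁⟩ := Finset.mem_erase.1 he
    have h := ht₁ e he₁ hne'
    refine ⟨Finset.mem_of_mem_erase (Finset.mem_of_mem_erase h), ?_, ?_⟩
    · rintro rfl; exact hb1 he₁
    · rintro rfl; exact ht1 he₁
  have hA₁card : A₁.card + 1 = E₁.card := Finset.card_erase_add_one hs₁
  -- Step 2: `A₁ ⊆ E₁' ∪ E₂'`
  have hA₁U : ∀ e ∈ A₁, e ∈ E₁' ∨ e ∈ E₂' := by
    intro e he
    obtain ⟨heE, hnb, hnt⟩ := hA₁E e he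
    have : e ∈ plaqFlip E v' := by
      unfold plaqFlip
      exact Finset.mem_union_left _ (Finset.mem_erase.2 ⟨hnt, Finset.mem_erase.2 ⟨hnb, heE⟩⟩)
    rw [← hU'] at this
    exact Finset.mem_union.1 this
  -- Step 3: open `E₁` at `s₁`; the arc is a path, hence inside ONE piece `E*`
  obtain ⟨P, hPpath, hPe, hPs₁, hPlen, hPsupp⟩ := hP₁.exists_isPath_erase hs₁
  have hPedges : ∀ e, e ∈ P.edges ↔ e ∈ A₁ := fun e => by rw [← List.mem_toFinset, hPe]
  have hone := walk_edges_one_piece hdis' P (fun e he => hA₁U e ((hPedges e).1 he))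
  -- generic conclusion from `A₁ ⊆ E*` for a piece `E*` of the `v'`-flip
  have main : ∀ {Es Et : Finset (Sym2 (Site 2))}, IsPolygon (zdGraph 2) Es → IsPolygon (zdGraph 2) Et →
      Disjoint (vertsOf Es) (vertsOf Et) → Es ∪ Et = plaqFlip E v' → Es.card = Et.card →
      (∀ e ∈ A₁, e ∈ Es) → False := by
    intro Es Et hPs hPt hdst hUst hcst hsub
    have hcs := two_mul_card_piece hb' ht' hl' hr' hdst hUst hcst
    have hEs1 : Es.card = E₁.card := by omega
    -- `Es` contains a vertical side `s'` of `P(v')`, which is not in `E`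
    have hs' := sidesSplit E Es v' hE hb' hPs (hUst ▸ Finset.subset_union_left)
    obtain ⟨s', hs'mem, hs'E, hs'vert⟩ : ∃ s', s' ∈ Es ∧ s' ∉ E ∧ (s' = plaqLeft v' ∨ s' = plaqRight v') := by
      rcases hs' with h | h
      · exact ⟨_, h, hl', Or.inl rfl⟩
      · exact ⟨_, h, hr', Or.inr rfl⟩
    -- counting: `A₁ ⊆ Es − s'` and `|A₁| = |Es| − 1`, so `Es = insert s' A₁`
    have hsub' : A₁ ⊆ Es.erase s' := fun e he =>
      Finset.mem_erase.2 ⟨fun h => hs'E (h ▸ (hA₁E e he).1), hsub e he⟩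
    have hEq : A₁ = Es.erase s' := Finset.eq_of_subset_of_card_le hsub' (by
      have := Finset.card_erase_add_one hs'mem; omega)
    have hEs : Es = insert s' A₁ := by rw [hEq, Finset.insert_erase hs'mem]
    have hs'A : s' ∉ A₁ := fun h => hs'E (hA₁E _ h).1
    have hs₁A : s₁ ∉ A₁ := Finset.notMem_erase _ _
    have hE₁ : E₁ = insert s₁ A₁ := by rw [hA₁, Finset.insert_erase hs₁]
    -- degree parity at the endpoints `p`, `p + ey` of `s₁`: both lie on `s'`
    have hends : ∀ x : Site 2, x ∈ s₁ → x ∈ s' := by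
      intro x hx
      have h1 := even_card_filter_mem hP₁ x
      have h2 := even_card_filter_mem hPs x
      rw [hE₁, card_filter_insert_of_notMem hs₁A, if_pos hx] at h1
      rw [hEs, card_filter_insert_of_notMem hs'A] at h2
      by_contra hxs
      rw [if_neg hxs, add_zero] at h2
      exact (Nat.even_add_one.1 h1) h2
    have hp1 := hends p (Sym2.mem_mk_left _ _)
    have hp2 := hends (p + ey) (Sym2.mem_mk_right _ _)
    have hpq : p ≠ p + ey := by
      intro h; have := congrFun h 1; simp at this
    have hs's₁ : s' = s₁ := by
      induction s' using Sym2.ind with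
      | _ x y =>
        rcases Sym2.mem_iff.1 hp1 with rfl | rfl <;> rcases Sym2.mem_iff.1 hp2 with h | h
        · exact absurd h.symm hpq
        · rw [← h]
        · rw [← h, Sym2.eq_swap]
        · exact absurd h.symm hpq
    -- Step 6: so `s₁` is a vertical side of `P(v')`: `p ∈ {v', v' + ex}`; with `p ∈ {v, v+ex}`, `v ≠ v'`,
    -- the two plaquettes are horizontal neighbours and `s(p - ex, p), s(p, p + ex) ∈ E`
    have hpv' : p = v' ∨ p = v' + ex := by
      have h := hs's₁
      rcases hs'vert with rfl | rfl
      · left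
        rw [plaqLeft_eq, hs₁def, show s(p, p + ey) = vEdge (p 0) (p 1) from by
          unfold vEdge; congr 1 <;> funext i <;> fin_cases i <;> simp] at h
        obtain ⟨h0, h1⟩ := vEdge_inj h
        exact (site_eq_iff p v').2 ⟨h0.symm, h1.symm⟩
      · right
        rw [plaqRight_eq, hs₁def, show s(p, p + ey) = vEdge (p 0) (p 1) from by
          unfold vEdge; congr 1 <;> funext i <;> fin_cases i <;> simp] at h
        obtain ⟨h0, h1⟩ := vEdge_inj h
        exact (site_eq_iff p (v' + ex)).2 ⟨by simp; omega, by simp; omega⟩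
    have hhor : s(p - ex, p) ∈ E ∧ s(p, p + ex) ∈ E ∧ s(p - ex, p) ∉ A₁ ∧ s(p, p + ex) ∉ A₁ := by
      have nb : plaqBot v ∉ A₁ := fun h =>
        (Finset.mem_erase.1 (Finset.mem_of_mem_erase (ht₁ _ (Finset.mem_of_mem_erase h) (Finset.mem_erase.1 h).1))).1 rfl
      have nb' : plaqBot v' ∉ A₁ := fun h => (hA₁E _ h).2.1 rfl
      rcases hpv with rfl | rfl <;> rcases hpv' with h | h
      · exact absurd h hne
      · -- `p = v = v' + ex`: `bot v' = s(p - ex, p)`, `bot v = s(p, p + ex)`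
        have e1 : plaqBot v' = s(p - ex, p) := by
          unfold plaqBot; rw [h, add_sub_cancel_right]
        have e2 : plaqBot p = s(p, p + ex) := rfl
        exact ⟨e1 ▸ hb', e2 ▸ hb, e1 ▸ nb', e2 ▸ nb⟩
      · -- `v + ex = v'`: `bot v = s(v' - ex, v')`... here `p = v + ex`
        have e1 : plaqBot v = s(v + ex - ex, v + ex) := by
          unfold plaqBot; rw [add_sub_cancel_right]
        have e2 : plaqBot v' = s(v + ex, v + ex + ex) := by unfold plaqBot; rw [← h]
        exact ⟨e1 ▸ hb, e2 ▸ hb', e1 ▸ nb, e2 ▸ nb'⟩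
      · exfalso; apply hne
        have := congrArg (fun w => w - ex) h
        simpa using this
    obtain ⟨hEm, hEp, hAm, hAp⟩ := hhor
    -- Step 7: the arc edge of `E₁` at `p` must then be `s(p, p - ey)`
    obtain ⟨b₁, b₂, hb12, he1, he2, had1, had2⟩ :=
      hP₁.exists_two_edges ⟨s₁, hs₁, Sym2.mem_mk_left _ _⟩
    obtain ⟨b, heb, hadb, hbne⟩ : ∃ b, s(p, b) ∈ E₁ ∧ (zdGraph 2).Adj p b ∧ b ≠ p + ey := by
      by_cases h : b₁ = p + ey
      · exact ⟨b₂, he2, had2, fun h' => hb12 (h.trans h'.symm)⟩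
      · exact ⟨b₁, he1, had1, h⟩
    have hebA : s(p, b) ∈ A₁ := by
      rw [hA₁, Finset.mem_erase]
      refine ⟨fun h => hbne ?_, heb⟩
      rcases Sym2.eq_iff.1 h with ⟨-, h2⟩ | ⟨h1, -⟩
      · exact h2
      · exact absurd h1 hpq
    have hdown : s(p, p - ey) ∈ E := by
      rcases adj_cases hadb with rfl | rfl | rfl | rfl
      · exact absurd hebA hAp
      · rw [Sym2.eq_swap] at hebA; exact absurd hebA hAm
      · exact absurd rfl hbne
      · exact (hA₁E _ hebA).1
    -- Step 8: `p` has `E`-degree three — impossible in a polygon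
    have hdeg : (E.filter fun e => p ∈ e) = {s(p - ex, p), s(p, p + ex), s(p, p - ey)} := by
      ext e
      simp only [Finset.mem_filter, Finset.mem_insert, Finset.mem_singleton]
      constructor
      · rintro ⟨he, hpe⟩
        obtain ⟨c, rfl, hc⟩ := edge_at hE he hpe
        rcases adj_cases hc with rfl | rfl | rfl | rfl
        · exact Or.inr (Or.inl rfl)
        · exact Or.inl Sym2.eq_swap
        · exact absurd he hs₁E
        · exact Or.inr (Or.inr rfl)
      · rintro (rfl | rfl | rfl)
        · exact ⟨hEm, Sym2.mem_mk_right _ _⟩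
        · exact ⟨hEp, Sym2.mem_mk_left _ _⟩
        · exact ⟨hdown, Sym2.mem_mk_left _ _⟩
    have h3 : (E.filter fun e => p ∈ e).card = 3 := by
      rw [hdeg]
      have n1 : s(p - ex, p) ≠ s(p, p + ex) := by
        intro h
        rcases Sym2.eq_iff.1 h with ⟨h1, -⟩ | ⟨h1, -⟩
        · have := congrFun h1 0; simp at this
        · have := congrFun h1 0; simp at this; omega
      have n2 : s(p - ex, p) ≠ s(p, p - ey) := by
        intro h
        rcases Sym2.eq_iff.1 h with ⟨h1, -⟩ | ⟨h1, -⟩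
        · have := congrFun h1 0; simp at this
        · have := congrFun h1 0; simp at this
      have n3 : s(p, p + ex) ≠ s(p, p - ey) := by
        intro h
        rcases Sym2.eq_iff.1 h with ⟨-, h2⟩ | ⟨-, h2⟩
        · have := congrFun h2 0; simp at this
        · have := congrFun h2 0; simp at this
      rw [Finset.card_insert_of_notMem, Finset.card_pair n3]
      simp only [Finset.mem_insert, Finset.mem_singleton]
      push Not; exact ⟨n1, n2⟩
    have := even_card_filter_mem hE p
    rw [h3] at this
    exact absurd this (by decide)
  rcases hone with h | h
  · exact main hP₁' hP₂' hdis' hU' hcard' (fun e he => h e ((hPedges e).2 he))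
  · exact main hP₂' hP₁' hdis'.symm (by rw [Finset.union_comm]; exact hU') hcard'.symm
      (fun e he => h e ((hPedges e).2 he))

/-- **(L3) `Interleave`**, proved. 
[cite: Madras1995LatticeAnimalsExponent, §2 (joining polygons across a plaquette; supporting lemma for the explicit form)] -/
theorem interleave : Interleave := by
  intro E hE v v' hne hv' E₁ E₂ hP₁ hP₂ hdis hU hcard hb ht hl hr
  exact ⟨interleave_one hE hne hv' hP₁ hP₂ hdis hU hcard hb ht hl hr,
    interleave_one hE hne hv' hP₂ hP₁ hdis.symm (by rw [Finset.union_comm]; exact hU) hcard.symm hb ht hl hr⟩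

end Interleave

/-! ### The composition (a-idea-2, Sketch_v6 v6.2, verbatim) and the unconditional S3 theorems -/

section Compose

/-- the S3 composition (checked): (L1) + (L2) + (L2′) + (L3) ⇒ parity distinctness. 
[cite: Madras1995LatticeAnimalsExponent, §2 (joining polygons across a plaquette; supporting lemma for the explicit form)] -/
theorem eqJoinParityDistinct_of (h1 : FlipParityIdentity) (h2 : TransportAlong) (h3 : SidesSplit)
    (h4 : Interleave) : EqJoinParityDistinct := by
  intro E hE v₁ v₂ hne hv₁ hv₂
  obtain ⟨hb, ht, hl, hr, E₁, E₂, hP₁, hP₂, hdis, hU, hcard⟩ := hv₁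
  have hs₁ : plaqLeft v₁ ∈ E₁ ∨ plaqRight v₁ ∈ E₁ :=
    h3 E E₁ v₁ hE hb hP₁ (hU ▸ Finset.subset_union_left)
  have hs₂ : plaqLeft v₁ ∈ E₂ ∨ plaqRight v₁ ∈ E₂ :=
    h3 E E₂ v₁ hE hb hP₂ (hU ▸ Finset.subset_union_right)
  have hi := h4 E hE v₁ v₂ hne hv₂ E₁ E₂ hP₁ hP₂ hdis hU hcard hb ht hl hr
  have a₁ : plaqBot v₁ ∈ E₁ ∨ plaqTop v₁ ∈ E₁ ∨ plaqLeft v₁ ∈ E₁ ∨ plaqRight v₁ ∈ E₁ :=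
    hs₁.elim (fun h => Or.inr (Or.inr (Or.inl h))) (fun h => Or.inr (Or.inr (Or.inr h)))
  have a₂ : plaqBot v₂ ∈ E₁ ∨ plaqTop v₂ ∈ E₁ ∨ plaqLeft v₂ ∈ E₁ ∨ plaqRight v₂ ∈ E₁ :=
    hi.1.elim (fun h => Or.inl h) (fun h => Or.inr (Or.inl h))
  have b₁ : plaqBot v₁ ∈ E₂ ∨ plaqTop v₁ ∈ E₂ ∨ plaqLeft v₁ ∈ E₂ ∨ plaqRight v₁ ∈ E₂ :=
    hs₂.elim (fun h => Or.inr (Or.inr (Or.inl h))) (fun h => Or.inr (Or.inr (Or.inr h)))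
  have b₂ : plaqBot v₂ ∈ E₂ ∨ plaqTop v₂ ∈ E₂ ∨ plaqLeft v₂ ∈ E₂ ∨ plaqRight v₂ ∈ E₂ :=
    hi.2.elim (fun h => Or.inl h) (fun h => Or.inr (Or.inl h))
  have t₂ : rayParity E₂ v₁ = rayParity E₂ v₂ := h2 E₂ E₁ hP₂ hP₁ hdis.symm v₁ v₂ a₁ a₂
  have t₁ : rayParity E₁ v₁ = rayParity E₁ v₂ := h2 E₁ E₂ hP₁ hP₂ hdis v₁ v₂ b₁ b₂
  have f₁ := h1 E E₁ E₂ v₁ v₁ hb ht hU hdis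
  have f₂ := h1 E E₁ E₂ v₁ v₂ hb ht hU hdis
  rw [if_pos rfl] at f₁
  rw [if_neg hne.symm, add_zero] at f₂
  intro heq
  have key : ∀ a : ZMod 2, a + 1 ≠ a := by decide
  apply key (rayParity E v₂)
  calc rayParity E v₂ + 1 = rayParity E v₁ + 1 := by rw [heq]
    _ = rayParity E₁ v₁ + rayParity E₂ v₁ := f₁.symm
    _ = rayParity E₁ v₂ + rayParity E₂ v₂ := by rw [t₁, t₂]
    _ = rayParity E v₂ := f₂

/-- parity distinctness ⇒ S3 («at most two»): three pairwise distinct values in `ZMod 2` do not exist. 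
[cite: Madras1995LatticeAnimalsExponent, §2 (joining polygons across a plaquette; supporting lemma for the explicit form)] -/
theorem atMostTwo_of_parityDistinct (h : EqJoinParityDistinct) : AtMostTwoEqJoinPlaquettes := by
  intro E hE v₁ v₂ v₃ h12 h13 h23 hv₁ hv₂ hv₃
  have key : ∀ a b c : ZMod 2, a ≠ b → a ≠ c → b ≠ c → False := by decide
  exact key _ _ _ (h E hE v₁ v₂ h12 hv₁ hv₂) (h E hE v₁ v₃ h13 hv₁ hv₃) (h E hE v₂ v₃ h23 hv₂ hv₃)

/-- parity distinctness ⇒ S3⁺ («unique interior equal-split neck»). 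
[cite: Madras1995LatticeAnimalsExponent, §2 (joining polygons across a plaquette; supporting lemma for the explicit form)] -/
theorem uniqueInteriorEqNeck_of_parityDistinct (h : EqJoinParityDistinct) : UniqueInteriorEqNeck :=
  fun E hE v₁ v₂ hne hv₁ hv₂ hp₁ hp₂ => h E hE v₁ v₂ hne hv₁ hv₂ (hp₁.trans hp₂.symm)

/-- **S3 core, PROVED: two distinct equal-split join plaquettes of a lattice polygon have different upward ray
parities.**
[cite: Madras1995LatticeAnimalsExponent, §2 (joining polygons across a plaquette; supporting lemma for the explicit form)] -/
theorem eqJoinParityDistinct : EqJoinParityDistinct :=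
  eqJoinParityDistinct_of flipParityIdentity transportAlong sidesSplit interleave

/-- **S3 («2JP lemma»), PROVED: a self-avoiding polygon of `ℤ²` has at most two equal-split join plaquettes.** 
[cite: Madras1995LatticeAnimalsExponent, §2 (joining polygons across a plaquette; supporting lemma for the explicit form)] -/
theorem atMostTwoEqJoinPlaquettes : AtMostTwoEqJoinPlaquettes := atMostTwo_of_parityDistinct eqJoinParityDistinct

/-- **S3⁺, PROVED: a lattice polygon has at most one equal-split join plaquette of odd ray parity.**
[cite: Madras1995LatticeAnimalsExponent, §2 (joining polygons across a plaquette; supporting lemma for the explicit form)] -/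
theorem uniqueInteriorEqNeck : UniqueInteriorEqNeck := uniqueInteriorEqNeck_of_parityDistinct eqJoinParityDistinct

end Compose

end Literature.Probability.RandomPlanarGeometry.SAW.JoinParity
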